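import Summits.Schanuel.Schanuel.Theorems.RootDecomp1GradedConeLadder

/-!
# RootDecomp1GradedCone — part 5/5 of the port of lens-1 gen 13 «GRADED CONE» (route RootDecomp1 rev 22; THEOREM ROUND, critic VERDICT 2026-08-30T16:07:00Z ACCEPTED, (iii)-partial grade transfer = STRUCTURE currency; port optional-LOW (b))

§§7–8: THE GRADED DECIDING THEOREM — schanuelAt_of_graded / _of_natural / schanuelAt_three_natural, closes_cofinal / closes_graded / closes_natural, closes_via_route through the LIVE six-binder closes (ladderCollapseGlue_of_graded a plain theorem; 26483 is closed), §8 literal type checks (examples).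

Port (census-1 gen 8) of HOME/decomp-schanuel-lens-1/g13/GradedCone.lean (sha256 abae003f…, 1137 l, 74 theorems; rc 0 against rev 22). Hygiene per the critic:
h1 the graded `def … : Prop` are GRADINGS of the rows S / B / U⊥ / U♮ / Cⁿᵘ (cell definitions of this file, not route items and not cited facts);
h2 explicit `FaithfulSMul` instance kept; h3 the §8 `example` block stays; h4 `ladderCollapseGlue_of_graded` is a plain theorem (26483 closed by p778320);
h5 advisory lint.theses-cone expected (imports Theses.RootDecomp1). Namespace `Summit.Schanuel.Schanuel.Theorems.RootDecomp1GradedCone`; statements and proofs verbatim.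
`--supports stmt-Schanuel-25020`. Sorry-free; standard axioms. Nothing here proves Schanuel; rung 0.
-/

noncomputable section

set_option linter.dupNamespace false

namespace Summit.Schanuel.Schanuel.Theorems.RootDecomp1GradedCone

open Complex IntermediateField
open scoped BigOperators
open Summit.Schanuel.Schanuel.Theses.RootDecomp1 (SchanuelTwo EssentialCounterexamplesInEcl
  DefectOneSchanuel LinearSchanuel QuadraticSchanuel RationalImageSchanuel LadderCollapseGlue
  NonrationalSaturatedEssentialSchanuel closes)
open Summit.Schanuel.Schanuel.Theorems.RootDecomp1EssentialInEcl (essentialCounterexamplesInEcl_holds)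
open Literature.NumberTheory.Transcendental (transcendental_exp_holds)
open Literature.NumberTheory.Transcendental.OneMotiveToric (trdeg_mono)
open Literature.NumberTheory.Transcendental.Philippon1986_criterion (trdeg_adjoin_range_le)
open Literature.Barriers.Schanuel (algebraicIndependent_of_le_trdeg_adjoin
  trdeg_adjoin_union_eq_of_isAlgebraic)
open Summit.Schanuel.Schanuel.Theorems.RootDecomp1LadderCollapse (Qbar quad aeval_mem_adjoin exists_nat_trdeg_range
  algCoeff_map eval_map_Qbar aeval_quad totalDegree_quad_le gadget_rigid)
open Literature.RingTheory.MvPolynomial.Ruppert (totalDegree_pow_of_ne_zero)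


/-! ## 7. THE GRADED DECIDING THEOREM -/

/-- **GRADED DECIDING THEOREM (core).**  `Sₙ` follows from `S₂`, from `B₄, …, Bₙ₊₁` (the saturation
padding: look-ahead ONE), from the three clauses (affine, quadratic, rational) at every ℚ-l.i. tuple of
each length `3 ≤ m ≤ n`, and from `Cⁿᵘ₃, …, Cⁿᵘₙ` — the route's own induction with graded binders
(K is the closed support item, discharged by `essentialCounterexamplesInEcl_holds`). -/
theorem schanuelAt_of_clauses (n : ℕ) (h₂ : SchanuelTwo)
    (hB : ∀ m, 4 ≤ m → m ≤ n + 1 → DefectOneAt m)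
    (hcl : ∀ m, 3 ≤ m → m ≤ n → ∀ z : Fin m → ℂ, LinearIndependent ℚ z →
      AffineClause z ∧ QuadraticClause z ∧ RationalClause z)
    (hC : ∀ m, m ≤ n → NonrationalSatEssAt m) : SchanuelAt n := by
  classical
  have hB' : ∀ m, m ≤ n + 1 → DefectOneAt m := fun m hm =>
    if h3 : m ≤ 3 then defectOneAt_of_le_three h₂ h3 else hB m (by omega) hm
  -- (1) adjoining elements algebraic over an intermediate field K does not raise trdeg above trdeg K
  have htr : ∀ (K : IntermediateField ℚ ℂ) (T : Set ℂ), (∀ x ∈ T, IsAlgebraic (↥K) x) →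
      Algebra.trdeg ℚ ↥(IntermediateField.adjoin ℚ T) ≤ Algebra.trdeg ℚ ↥K := by
    intro K T hT
    have hsub : IntermediateField.adjoin ℚ T ≤ IntermediateField.adjoin ℚ ((K : Set ℂ) ∪ T) :=
      IntermediateField.adjoin.mono ℚ _ _ Set.subset_union_right
    have hmono : Algebra.trdeg ℚ ↥(IntermediateField.adjoin ℚ T) ≤
        Algebra.trdeg ℚ ↥(IntermediateField.adjoin ℚ ((K : Set ℂ) ∪ T)) :=
      trdeg_le_of_injective (IntermediateField.inclusion hsub)
        (IntermediateField.inclusion_injective hsub)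
    refine hmono.trans (le_of_eq ?_)
    haveI : Algebra.IsAlgebraic (↥K) ↥(IntermediateField.adjoin (↥K) T) :=
      IntermediateField.isAlgebraic_adjoin fun x hx => (hT x hx).isIntegral
    have h := trdeg_add_eq ℚ (↥K) (A := ↥(IntermediateField.adjoin (↥K) T))
    rw [trdeg_eq_zero (R := ↥K) (A := ↥(IntermediateField.adjoin (↥K) T)), add_zero] at h
    have e := (IntermediateField.equivOfEq
      (IntermediateField.restrictScalars_adjoin ℚ K T)).symm.trdeg_eq
    calc Algebra.trdeg ℚ ↥(IntermediateField.adjoin ℚ ((K : Set ℂ) ∪ T))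
        = Algebra.trdeg ℚ ↥((IntermediateField.adjoin (↥K) T).restrictScalars ℚ) := e
      _ = Algebra.trdeg ℚ ↥(IntermediateField.adjoin (↥K) T) := rfl
      _ = Algebra.trdeg ℚ ↥K := h.symm
  -- (2) the padding step at level m consumes B_{m+1}
  have hpad : ∀ (m : ℕ), m + 1 ≤ n + 1 → ∀ (z : Fin m → ℂ), LinearIndependent ℚ z → ∀ (w : ℂ),
      IsAlgebraic ↥(IntermediateField.adjoin ℚ (Set.range z ∪ Set.range (Complex.exp ∘ z))) w →
      IsAlgebraic ↥(IntermediateField.adjoin ℚ (Set.range z ∪ Set.range (Complex.exp ∘ z)))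
        (Complex.exp w) →
      w ∉ Submodule.span ℚ (Set.range z) →
      (m : Cardinal) ≤ Algebra.trdeg ℚ
        ↥(IntermediateField.adjoin ℚ (Set.range z ∪ Set.range (Complex.exp ∘ z))) := by
    intro m hm z hz w hw1 hw2 hw3
    set K : IntermediateField ℚ ℂ :=
      IntermediateField.adjoin ℚ (Set.range z ∪ Set.range (Complex.exp ∘ z)) with hKdef
    have hgen : ∀ x ∈ Set.range z ∪ Set.range (Complex.exp ∘ z), IsAlgebraic (↥K) x :=
      fun x hx => isAlgebraic_algebraMap (⟨x, IntermediateField.subset_adjoin ℚ _ hx⟩ : ↥K)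
    have hli : LinearIndependent ℚ (Fin.cons w z : Fin (m + 1) → ℂ) :=
      linearIndependent_finCons.mpr ⟨hz, hw3⟩
    have h1 := hB' (m + 1) hm (Fin.cons w z) hli
    have hgens : ∀ x ∈ Set.range (Fin.cons w z : Fin (m + 1) → ℂ) ∪
        Set.range (Complex.exp ∘ (Fin.cons w z : Fin (m + 1) → ℂ)), IsAlgebraic (↥K) x := by
      rintro x (⟨i, rfl⟩ | ⟨i, rfl⟩)
      · refine Fin.cases ?_ (fun j => ?_) i
        · simpa using hw1
        · simp only [Fin.cons_succ]
          exact hgen _ (Or.inl ⟨j, rfl⟩)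
      · refine Fin.cases ?_ (fun j => ?_) i
        · simpa using hw2
        · simp only [Function.comp_apply, Fin.cons_succ]
          exact hgen _ (Or.inr ⟨j, rfl⟩)
    have h2 := htr K _ hgens
    have h3 : ((m + 1 : ℕ) : Cardinal) ≤ Algebra.trdeg ℚ ↥K + 1 :=
      h1.trans (add_le_add h2 le_rfl)
    have h4 : ((m + 1 : ℕ) : Cardinal) = (m : Cardinal) + 1 := by push_cast; rfl
    rw [h4] at h3
    exact (Cardinal.add_le_add_iff_of_lt_aleph0 Cardinal.one_lt_aleph0).mp h3
  -- (3) strong induction on the length, up to n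
  suffices key : ∀ m, m ≤ n → SchanuelAt m from key n le_rfl
  intro m
  induction m using Nat.strong_induction_on with
  | _ m ih =>
    intro hmn z hz
    rcases Nat.lt_or_ge m 3 with hlt | hge
    · interval_cases m
      · simp
      · exact schanuelAt_one z hz
      · exact h₂ z hz
    · by_contra hlt
      have hlt' : Algebra.trdeg ℚ
          ↥(IntermediateField.adjoin ℚ (Set.range z ∪ Set.range (Complex.exp ∘ z))) < (m : Cardinal) :=
        lt_of_not_ge hlt
      have hgen : ∀ (m' : ℕ), m' < m → ∀ (w : Fin m' → ℂ), LinearIndependent ℚ w →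
          (∀ i, w i ∈ Submodule.span ℚ (Set.range z)) →
          (m' : Cardinal) ≤ Algebra.trdeg ℚ
            ↥(IntermediateField.adjoin ℚ (Set.range w ∪ Set.range (Complex.exp ∘ w))) :=
        fun m' hm' w hw _ => ih m' hm' (by omega) w hw
      have hecl := essentialCounterexamplesInEcl_holds m z hz hgen hlt'
      by_cases hsat : ∀ w : ℂ,
          IsAlgebraic ↥(IntermediateField.adjoin ℚ (Set.range z ∪ Set.range (Complex.exp ∘ z))) w →
          IsAlgebraic ↥(IntermediateField.adjoin ℚ (Set.range z ∪ Set.range (Complex.exp ∘ z)))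
            (Complex.exp w) →
          w ∈ Submodule.span ℚ (Set.range z)
      · obtain ⟨hlin, hquad, hrat⟩ := hcl m hge hmn z hz
        exact hlt (hC m hmn hge z hz hecl hgen hsat hlin hquad hrat)
      · push Not at hsat
        obtain ⟨w, hw1, hw2, hw3⟩ := hsat
        exact hlt (hpad m (by omega) z hz w hw1 hw2 hw3)

/-- **ROUTE FORM** (U⊥ carrying its clauses: look-ahead TWO).  For every `M ≥ n + 2`:
`S₂ ∧ ⋀_{4 ≤ m ≤ M} Bₘ ∧ U⊥_M ∧ ⋀_{3 ≤ m ≤ n} Cⁿᵘₘ ⟹ Sₙ`. -/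
theorem schanuelAt_of_graded (n M : ℕ) (hM : n + 2 ≤ M) (h₂ : SchanuelTwo)
    (hB : ∀ m, 4 ≤ m → m ≤ M → DefectOneAt m) (hU : RationalImageAt M)
    (hC : ∀ m, m ≤ n → NonrationalSatEssAt m) : SchanuelAt n := by
  have hB' : ∀ m, m ≤ M → DefectOneAt m := fun m hm =>
    if h3 : m ≤ 3 then defectOneAt_of_le_three h₂ h3 else hB m (by omega) hm
  refine schanuelAt_of_clauses n h₂ (fun m h4 hm => hB m h4 (by omega)) (fun m h3 hm z hz => ?_) hC
  have hmM : m + 2 ≤ M := by omega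
  obtain ⟨hR, -, hL, hQ⟩ := rows_of_higher hmM (hB' m (by omega)) (hB' M le_rfl) hU
  exact ⟨hL z hz, hQ z hz (hL z hz), hR z hz⟩

/-- **NATURAL FORM** (clause-free U♮: no look-ahead in U, look-ahead one in B).  For every `N ≥ n`:
`S₂ ∧ ⋀_{4 ≤ m ≤ n+1} Bₘ ∧ U♮_N ∧ ⋀_{3 ≤ m ≤ n} Cⁿᵘₘ ⟹ Sₙ`. -/
theorem schanuelAt_of_natural (n N : ℕ) (hN : n ≤ N) (h₂ : SchanuelTwo)
    (hB : ∀ m, 4 ≤ m → m ≤ n + 1 → DefectOneAt m) (hU : RationalAt N)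
    (hC : ∀ m, m ≤ n → NonrationalSatEssAt m) : SchanuelAt n := by
  have hB' : ∀ m, m ≤ n + 1 → DefectOneAt m := fun m hm =>
    if h3 : m ≤ 3 then defectOneAt_of_le_three h₂ h3 else hB m (by omega) hm
  refine schanuelAt_of_clauses n h₂ hB (fun m h3 hm z hz => ?_) hC
  exact clauses_of_rationalAt (rationalAt_of_le (by omega) (hB' m (by omega)) hU) z hz

/-- **FIRST OPEN LENGTH, route form.**  `S₂ → B₄ → B₅ → U⊥₅ → Cⁿᵘ₃ → S₃`. -/
theorem schanuelAt_three (h₂ : SchanuelTwo) (hB₄ : DefectOneAt 4) (hB₅ : DefectOneAt 5)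
    (hU₅ : RationalImageAt 5) (hC₃ : NonrationalSatEssAt 3) : SchanuelAt 3 := by
  refine schanuelAt_of_graded 3 5 le_rfl h₂ (fun m h4 h5 => ?_) hU₅ (fun m hm => ?_)
  · interval_cases m <;> assumption
  · by_cases h : m = 3
    · subst h; exact hC₃
    · intro h3; exact absurd h3 (by omega)

/-- **FIRST OPEN LENGTH, natural form.**  `S₂ → B₄ → U♮₃ → Cⁿᵘ₃ → S₃`: four cells, each at its
lowest grade (B₄ = the saturation padding; U♮₃, Cⁿᵘ₃ = the two halves of the saturated case). -/
theorem schanuelAt_three_natural (h₂ : SchanuelTwo) (hB₄ : DefectOneAt 4) (hU₃ : RationalAt 3)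
    (hC₃ : NonrationalSatEssAt 3) : SchanuelAt 3 := by
  refine schanuelAt_of_natural 3 3 le_rfl h₂ (fun m h4 h4' => ?_) hU₃ (fun m hm => ?_)
  · obtain rfl : m = 4 := le_antisymm h4' h4
    exact hB₄
  · by_cases h : m = 3
    · subst h; exact hC₃
    · intro h3; exact absurd h3 (by omega)

/-- **LENGTH 4, route form.**  `S₂ → B₄ → B₅ → B₆ → U⊥₆ → Cⁿᵘ₃ → Cⁿᵘ₄ → S₄`. -/
theorem schanuelAt_four (h₂ : SchanuelTwo) (hB₄ : DefectOneAt 4) (hB₅ : DefectOneAt 5)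
    (hB₆ : DefectOneAt 6) (hU₆ : RationalImageAt 6) (hC₃ : NonrationalSatEssAt 3)
    (hC₄ : NonrationalSatEssAt 4) : SchanuelAt 4 := by
  refine schanuelAt_of_graded 4 6 le_rfl h₂ (fun m h4 h6 => ?_) hU₆ (fun m hm => ?_)
  · interval_cases m <;> assumption
  · by_cases h : m = 3
    · subst h; exact hC₃
    · by_cases h' : m = 4
      · subst h'; exact hC₄
      · intro h3; exact absurd h3 (by omega)

/-- **GLOBAL GRADED CONE, route form.**
`S₂ → ⋀_{n ≥ 4} Bₙ → (U⊥ₘ for a cofinal set of m) → Cⁿᵘ → Schanuel`. -/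
theorem closes_graded (h₂ : SchanuelTwo) (hB : ∀ n, 4 ≤ n → DefectOneAt n)
    (hU : ∀ N : ℕ, ∃ m, N ≤ m ∧ RationalImageAt m) (hC : NonrationalSaturatedEssentialSchanuel) :
    _root_.Schanuel := by
  intro n
  obtain ⟨M, hM, hUM⟩ := hU (n + 2)
  exact schanuelAt_of_graded n M hM h₂ (fun m h4 _ => hB m h4) hUM (fun m _ => hC m)

/-- **GLOBAL GRADED CONE, natural form.**
`S₂ → ⋀_{n ≥ 4} Bₙ → (U♮ₘ for a cofinal set of m) → Cⁿᵘ → Schanuel`. -/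
theorem closes_natural (h₂ : SchanuelTwo) (hB : ∀ n, 4 ≤ n → DefectOneAt n)
    (hU : ∀ N : ℕ, ∃ m, N ≤ m ∧ RationalAt m) (hC : NonrationalSaturatedEssentialSchanuel) :
    _root_.Schanuel := by
  intro n
  obtain ⟨M, hM, hUM⟩ := hU n
  exact schanuelAt_of_natural n M hM h₂ (fun m h4 _ => hB m h4) hUM (fun m _ => hC m)

/-- **THE CONE IN COFINAL FORM.**  `S₂ → (Bₘ cofinally) → (U♮ₘ cofinally) → Cⁿᵘ → Schanuel`: the only rows
whose INDIVIDUAL grades are load-bearing are `S₂` (one grade) and the residual `Cⁿᵘ` (every grade ≥ 3). -/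
theorem closes_cofinal (h₂ : SchanuelTwo) (hB : ∀ N : ℕ, ∃ m, N ≤ m ∧ DefectOneAt m)
    (hU : ∀ N : ℕ, ∃ m, N ≤ m ∧ RationalAt m) (hC : NonrationalSaturatedEssentialSchanuel) :
    _root_.Schanuel :=
  closes_natural h₂ (fun n _ => defectOneSchanuel_of_cofinal hB n) hU hC


/-- The route's support item `LadderCollapseGlue` (stmt-Schanuel-26483: `B → U⊥ → L ∧ Q`, gen 12) from the
graded machinery of this file (an independent second proof; the item is closed by
`Theorems/RootDecomp1LadderCollapse.lean`). -/
theorem ladderCollapseGlue_of_graded : LadderCollapseGlue := fun hD hU =>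
  ⟨linearSchanuel_of_cofinal hD fun N => ⟨N, le_rfl, rationalImageSchanuel_iff.mp hU N⟩,
    quadraticSchanuel_of_cofinal hD fun N => ⟨N, le_rfl, rationalImageSchanuel_iff.mp hU N⟩⟩

/-- The same conclusion THROUGH THE ROUTE'S OWN `closes` (rev 22, six binders
`S₂ → K → B → U⊥ → LadderCollapseGlue → Cⁿᵘ`): the binders are reconstructed from the graded data
(`defectOneSchanuel_of_geFour`, `rationalImageSchanuel_of_cofinal`, `ladderCollapseGlue_of_graded`;
K is closed by `essentialCounterexamplesInEcl_holds`). -/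
theorem closes_via_route (h₂ : SchanuelTwo) (hB : ∀ n, 4 ≤ n → DefectOneAt n)
    (hU : ∀ N : ℕ, ∃ m, N ≤ m ∧ RationalImageAt m) (hC : NonrationalSaturatedEssentialSchanuel) :
    _root_.Schanuel :=
  have hD : DefectOneSchanuel := defectOneSchanuel_of_geFour h₂ hB
  closes h₂ essentialCounterexamplesInEcl_holds hD (rationalImageSchanuel_of_cofinal hD hU)
    ladderCollapseGlue_of_graded hC


/-! ## 8. Literal type checks against the live route decls -/

example : DefectOneSchanuel ↔ ∀ n, DefectOneAt n := Iff.rfl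
example : SchanuelTwo ↔ SchanuelAt 2 := Iff.rfl
example : _root_.Schanuel ↔ ∀ n, SchanuelAt n := Iff.rfl
example (hB : DefectOneSchanuel) : RationalImageSchanuel ↔ ∀ N : ℕ, ∃ m, N ≤ m ∧ RationalImageAt m :=
  ⟨fun h N => ⟨N, le_rfl, rationalImageSchanuel_iff.mp h N⟩, rationalImageSchanuel_of_cofinal hB⟩
/-- modulo B, the route's U⊥ is each cofinal family of grades of the clause-free U♮ -/
example (hB : DefectOneSchanuel) : RationalImageSchanuel ↔ ∀ N : ℕ, ∃ m, N ≤ m ∧ RationalAt m :=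
  ⟨fun h N => ⟨N, le_rfl, rationalAt_of_higher (le_refl (N + 2)) (hB N) (hB (N + 2))
      (rationalImageSchanuel_iff.mp h (N + 2))⟩,
   fun h => rationalImageSchanuel_iff.mpr fun n =>
      rationalImageAt_of_rationalAt (rationalAt_all_of_cofinal_natural hB h n)⟩
/-- the four-cell cone of the first open length -/
example : SchanuelTwo → DefectOneAt 4 → RationalAt 3 → NonrationalSatEssAt 3 → SchanuelAt 3 :=
  schanuelAt_three_natural
/-- the global cone in graded form, through the route's own deciding theorem -/
example : SchanuelTwo → (∀ n, 4 ≤ n → DefectOneAt n) → (∀ N : ℕ, ∃ m, N ≤ m ∧ RationalImageAt m) →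
    NonrationalSaturatedEssentialSchanuel → _root_.Schanuel := closes_via_route

end Summit.Schanuel.Schanuel.Theorems.RootDecomp1GradedCone
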